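import Summits.BirchSwinnertonDyer.Rank1Residual.GaloisImage.KolyvaginFiniteSingularTorsionPrelims
import Summits.BirchSwinnertonDyer.Rank1Residual.GaloisImage.KolyvaginDerivativeTate
import Literature.NumberTheory.EllipticCurves.GeomPointsGaloisModule
import HarnessLib

/-!
# The FAMILY of Kolyvagin's derivative classes of an Euler system of `T_p E / ℚ`, for a FIXED choice
# of generators, read in `H¹(ℚ, E[m])`
# (cell `b2b-bsdres`, n1011 p11 GEN 10; row T-DER, THEOREM D file D2; GZ-2's END with `σ` an
# INPUT, so that ONE family `κ : 𝒩 → H¹(ℚ, E[m])` serves every level)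

HONEST FRAMING (cell `b2b-bsdres`, run/shared/lean/b2b/bsd-rank1-residual/, verbatim in every
file): the goal of the cell is to DELETE the COMBINATION-SHAPED residual classes of the
Birch–Swinnerton-Dyer formula for ALL analytic-rank `≤ 1` elliptic curves over `ℚ` — "full BSD
formula for every rank `≤ 1` curve in class `C`" assembled STRICTLY from published theorems — so
that the rank-`≤ 1` remainder becomes exactly the CONSTRUCTION-SHAPED classes, which are TYPED
(missing-input `Prop`s), NOT attempted. This is not "finishing BSD". Team n1011: research route on
the CONSTRUCTION-SHAPED class X4 / §I N11 (route-1 PORT, (P-DER)); TOOL theorems: NO Euler system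
is asserted to exist (it is the hypothesis `hc`), no definition, no named fact, no `sorry`.

## What

A Kolyvagin system is ONE function on the levels `𝒩 = {d ⊆ 𝒫 finite}`; its classes at `d` and
`dq` must be built from the SAME generators `σ_ℓ`.  F5/GZ-2
(`Derivative.Rat.exists_sigma_existsUnique_res_eq_deriv_tate`,
`TorsionCoeff.Rat.exists_sigma_existsUnique_res_eq_deriv_torsionGaloisModule`) produce the generators
per level (`∃ σ`).  This file takes `σ` as an INPUT with the T-DER-INST shapes on every finite
`r ⊆ 𝒫` (D1 `CyclotomicLevel.Rat.exists_sigma_mem_inertia_adicCompletionPrime` supplies such a `σ`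
for all places at once) and proves, for an Euler system `c` of `T_pE` over `cyclotomicLevelsRat p S`
(HYPOTHESIS `hc`), a `ℤ_p`-linear quotient `red : T_pE ⟶ T′` killed by `p^n` read in `E[m]` through
an additive continuous equivariant bijection `e : T′ → E[m]` (instance-free, as GZ-4 / C5b-β), a set
`𝒫` of Kolyvagin primes of level `n` off `S ∪ {p}`, and `E[m]^{Gal(ℚ̄/ℚ(μ_r))} = 0` at every level:
* `existsUnique_res_eq_deriv_tate_of_sigma` — F5 with `σ` given: `∃! κ′_r ∈ H¹(ℚ, T′)` with
  `res_{U_r} κ′_r = D_r (red_* c_{0,r})`;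
* **`exists_derivativeFamily`** — transports `Φ_r : H¹(U_r, T′) →+ H¹(U_r, E[m])` computed on
  cocycles by `e` (GZ-1) for all `r`, and ONE family `κ : Finset → H¹(ℚ, E[m])` with `κ r = 0` off
  the levels and, at every level `r ⊆ 𝒫`, `res_{U_r} (κ r) = D_r (Φ_r (red_* c_{0,r}))` with `κ r`
  UNIQUE for it (Rubin's `κ_{[ℚ, r, M]}`, [Rubin00] Def. 4.4.10; [MR04] App. A (32)).
0 defs, 0 facts.  References: K. Rubin, *Euler Systems* (2000), Def. 4.4.1, Def. 4.4.10, Lemma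
4.4.13; B. Mazur, K. Rubin, Mem. AMS 799 (2004), App. A (32).
-/

noncomputable section

open CategoryTheory Function Finset Polynomial Field IsDedekindDomain
open scoped NumberField
open Literature.NumberTheory.GaloisRepresentations Literature.NumberTheory.EllipticCurves
open Literature.NumberTheory.GaloisCohomology
open Summit.BirchSwinnertonDyer.Rank1Residual.GaloisImage.CoeffTransport
open Summit.BirchSwinnertonDyer.Rank1Residual.GaloisImage.CyclotomicLevel
open Rat.HeightOneSpectrum

universe u

namespace Summit.BirchSwinnertonDyer.Rank1Residual.GaloisImage.Derivative.Rat

variable (W : WeierstrassCurve ℚ) [W.IsElliptic] [W.IsGloballyMinimal] (p : ℕ) [Fact p.Prime]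
variable [Module.Free ℤ_[p] (W.tateModule p)] [Module.Finite ℤ_[p] (W.tateModule p)]
  [ContinuousSMul ℤ_[p] (W.tateModule p)]

/-- Local notation: `T∞ = T_p E` as a continuous `G_ℚ`-representation. -/
local notation3 "T∞" => WeierstrassCurve.tateGaloisRep W p (W.continuous_galoisRepTate_holds p)

/-- Local notation: `𝐫⟦f, T′, U⟧ = f_* : H¹(U, T_pE) → H¹(U, T′)`. -/
local notation3 (prettyPrint := false) "𝐫⟦" f ", " Tg ", " U "⟧" =>
  ContinuousCohomology.map (ContinuousMonoidHom.id _)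
    (X := subgroupRep (ContinuousRep.toTopRep T∞) U)
    (Y := subgroupRep (ContinuousRep.toTopRep Tg) U)
    ((TopRep.resFunctor (Subgroup.subtype U)).map f) 1

variable (S : Set (HeightOneSpectrum (𝓞 ℚ)))

/-- Local notation: `𝓛` = the cyclotomic Euler-system levels `ℚ(μ_{p^{n+1}}, μ_r)`, `r ∩ S = ∅`. -/
local notation3 "𝓛" => cyclotomicLevelsRat p S

/-- Local notation: `𝐃⟦A, X, U, τ⟧ ℓ = ∑_{j < ℓ−1} j·(τ_ℓ)_*^j`, Kolyvagin's derivative operator of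
the place `ℓ` on `H¹(U, X)` (`A`-linear) for the generator `τ_ℓ`. -/
local notation3 (prettyPrint := false) "𝐃⟦" A ", " X ", " U ", " τ "⟧" =>
  fun ℓ : HeightOneSpectrum (𝓞 ℚ) =>
  ∑ j ∈ Finset.range (((primesEquiv ℓ : Nat.Primes) : ℕ) - 1),
    (j : Module.End A (continuousCohomology 1 (subgroupRep X U))) *
      (conjMap X U ((τ : HeightOneSpectrum (𝓞 ℚ) → absoluteGaloisGroup ℚ) ℓ) 1).hom.toLinearMap ^ j

/-- **F5 with the generators GIVEN** (`Derivative.Rat.exists_sigma_existsUnique_res_eq_deriv_tate`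
without its `∃ σ`): for an Euler system `c` of `T_pE` over `cyclotomicLevelsRat p S`, a `ℤ_p`-linear
`red : T_pE ⟶ T′` with `p^k T′ = 0`, a level `r` of Kolyvagin primes of level `k ≥ 1`, generators
`σ_ℓ` with the INST shapes on `r`, and `(T′)^{U_r} = 0`: **`∃! κ ∈ H¹(ℚ, T′)` with
`res_{U_r} κ = D_r (red_* c_{0,r})`** (the `hram`, `hM₁`, `hM₂`, `hFr` binders of F4
`Derivative.existsUnique_res_eq_deriv` discharged as in F5). [cite: Rubin2000, Def. 4.4.10 and Lemma 4.4.13] -/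
theorem existsUnique_res_eq_deriv_tate_of_sigma {k : ℕ} (hk : 0 < k)
    {c : ∀ (i : ℕ) (r : (𝓛).Ideals), H1 T∞ ((𝓛).level i r.1)}
    (hc : IsEulerSystem 𝓛 T∞ p c)
    {M' : Type} [AddCommGroup M'] [Module ℤ_[p] M'] [TopologicalSpace M'] [IsTopologicalAddGroup M']
    [ContinuousSMul ℤ_[p] M'] {T' : GaloisRep ℚ ℤ_[p] M'} (red : T∞.toTopRep ⟶ T'.toTopRep)
    (hM : ∀ m : M', ((p : ℤ_[p]) ^ k) • m = 0) (r : (𝓛).Ideals)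
    (hr : ∀ ℓ ∈ r.1, Kato.IsKolyvaginPrime W p k ((primesEquiv ℓ : Nat.Primes) : ℕ))
    (σ : HeightOneSpectrum (𝓞 ℚ) → absoluteGaloisGroup ℚ)
    (hσ : ∀ ℓ ∈ r.1, ∀ q ∈ r.1, q ≠ ℓ → σ ℓ ∈ (𝓛).tameLevel q)
    (hcov : ∀ ℓ ∈ r.1, ∀ g : absoluteGaloisGroup ℚ,
      ∃ j < ((primesEquiv ℓ : Nat.Primes) : ℕ) - 1, (σ ℓ ^ j)⁻¹ * g ∈ (𝓛).tameLevel ℓ)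
    (hinj : ∀ ℓ ∈ r.1, ∀ j₁ < ((primesEquiv ℓ : Nat.Primes) : ℕ) - 1,
      ∀ j₂ < ((primesEquiv ℓ : Nat.Primes) : ℕ) - 1,
        (σ ℓ ^ j₁)⁻¹ * σ ℓ ^ j₂ ∈ (𝓛).tameLevel ℓ → j₁ = j₂)
    (h0 : ∀ v : T'.toTopRep, (∀ u : (𝓛).level ⊥ r.1,
      T'.toTopRep.ρ (u : absoluteGaloisGroup ℚ) v = v) → v = 0) (comm) :
    ∃! κ : continuousCohomology 1 T'.toTopRep,
      resSubgroup T'.toTopRep ((𝓛).level ⊥ r.1) 1 κ =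
        (r.1.noncommProd 𝐃⟦ℤ_[p], T'.toTopRep, ((𝓛).level ⊥ r.1), σ⟧ comm)
          (𝐫⟦red, T', ((𝓛).level ⊥ r.1)⟧ (c ⊥ r)) := by
  classical
  obtain ⟨Fr, hFr⟩ := CyclotomicLevel.exists_frobenius ℚ
  have h2 : ∀ ℓ ∈ r.1, ((primesEquiv ℓ : Nat.Primes) : ℕ) ≠ 2 :=
    fun ℓ hℓ => ne_two_of_isKolyvaginPrime W p hk (hr ℓ hℓ)
  have hram : ∀ ℓ ∈ r.1, ∀ s ⊆ r.1, ℓ ∉ s →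
      ¬ SubgroupIsUnramifiedAt ℚ ((𝓛).level ⊥ (insert ℓ s)) ℓ :=
    fun ℓ hℓ s _ _ =>
      CyclotomicLevel.Rat.not_subgroupIsUnramifiedAt_cyclotomicLevelsRat_level_insert p S ⊥ (h2 ℓ hℓ) s
  have hM₁ : ∀ ℓ ∈ r.1, ∀ v : M',
      ((((primesEquiv ℓ : Nat.Primes) : ℕ) - 1 : ℕ) : ℤ_[p]) • v = 0 :=
    fun ℓ hℓ v => CyclotomicLevel.Rat.natCast_sub_one_smul_eq_zero_of_isKolyvaginPrime W hM (hr ℓ hℓ) v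
  have hM₂ : ∀ ℓ ∈ r.1, ∀ v : M',
      (rubinEulerFactor T∞.toRepresentation (cyclotomicCharacterToUnits ℚ p ℤ_[p]) (Fr ℓ)).eval 1 • v
        = 0 :=
    fun ℓ hℓ v =>
      CyclotomicLevel.Rat.eval_one_rubinEulerFactor_galoisRepTate_smul_eq_zero W hM (hr ℓ hℓ) (hFr ℓ) v
  exact existsUnique_res_eq_deriv hc red r σ _ Fr hσ hcov hinj (fun ℓ _ => hFr ℓ) hram hM₁ hM₂ _ h0

/-- **THE FAMILY of Kolyvagin's derivative classes, read in `H¹(ℚ, E[m])`** (see the module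
docstring): transports `Φ_r` for all finite `r` and ONE function `κ` on the finite sets of places,
vanishing off the levels `{r : ↑r ⊆ 𝒫}` and characterised at every level by
`res_{U_r} (κ r) = D_r (Φ_r (red_* c_{0,r}))`, uniquely.
[cite: Rubin2000, Def. 4.4.10 and Lemma 4.4.13] [cite: MazurRubin2004, App. A (32)] -/
theorem exists_derivativeFamily
    {c : ∀ (i : ℕ) (r : (𝓛).Ideals), H1 T∞ ((𝓛).level i r.1)}
    (hc : IsEulerSystem 𝓛 T∞ p c)
    {M' : Type} [AddCommGroup M'] [Module ℤ_[p] M'] [TopologicalSpace M'] [IsTopologicalAddGroup M']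
    [ContinuousSMul ℤ_[p] M'] {T' : GaloisRep ℚ ℤ_[p] M'} (red : T∞.toTopRep ⟶ T'.toTopRep)
    {n : ℕ} (hn : 0 < n) (hM : ∀ m : M', ((p : ℤ_[p]) ^ n) • m = 0) {m : ℤ}
    (e : M' →+ WeierstrassCurve.geomTorsion W m) (hec : Continuous e)
    (he : ∀ (g : absoluteGaloisGroup ℚ) (x : M'),
      e (T'.toTopRep.ρ g x) = (W.torsionGaloisModule m).toTopRep.ρ g (e x))
    (einv : WeierstrassCurve.geomTorsion W m →+ M') (hic : Continuous einv)
    (h₁ : ∀ x, einv (e x) = x) (h₂ : ∀ y, e (einv y) = y)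
    (Pr : Set (HeightOneSpectrum (𝓞 ℚ))) (hPr : Pr ⊆ (𝓛).primes)
    (hKol : ∀ ℓ ∈ Pr, Kato.IsKolyvaginPrime W p n ((primesEquiv ℓ : Nat.Primes) : ℕ))
    (σ : HeightOneSpectrum (𝓞 ℚ) → absoluteGaloisGroup ℚ)
    (hσ : ∀ r : Finset (HeightOneSpectrum (𝓞 ℚ)), (↑r : Set _) ⊆ Pr →
      (∀ ℓ ∈ r, ∀ ℓ₂ ∈ r, ℓ₂ ≠ ℓ → σ ℓ ∈ (𝓛).tameLevel ℓ₂) ∧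
      (∀ ℓ ∈ r, ∀ g : absoluteGaloisGroup ℚ,
        ∃ j < ((primesEquiv ℓ : Nat.Primes) : ℕ) - 1, (σ ℓ ^ j)⁻¹ * g ∈ (𝓛).tameLevel ℓ) ∧
      (∀ ℓ ∈ r, ∀ j₁ < ((primesEquiv ℓ : Nat.Primes) : ℕ) - 1,
        ∀ j₂ < ((primesEquiv ℓ : Nat.Primes) : ℕ) - 1,
          (σ ℓ ^ j₁)⁻¹ * σ ℓ ^ j₂ ∈ (𝓛).tameLevel ℓ → j₁ = j₂))
    (h0 : ∀ r : Finset (HeightOneSpectrum (𝓞 ℚ)), (↑r : Set _) ⊆ Pr →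
      ∀ P : WeierstrassCurve.geomTorsion W m,
        (∀ u : (𝓛).level ⊥ r, (u : absoluteGaloisGroup ℚ) • P = P) → P = 0) :
    ∃ (Φ : ∀ r : Finset (HeightOneSpectrum (𝓞 ℚ)),
        continuousCohomology 1 (subgroupRep T'.toTopRep ((𝓛).level ⊥ r)) →+
          continuousCohomology 1 (subgroupRep (W.torsionGaloisModule m).toTopRep ((𝓛).level ⊥ r)))
      (comm : ∀ r : Finset (HeightOneSpectrum (𝓞 ℚ)),
        ((r : Finset _) : Set (HeightOneSpectrum (𝓞 ℚ))).Pairwise fun a b =>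
          Commute (𝐃⟦ℤ, (W.torsionGaloisModule m).toTopRep, ((𝓛).level ⊥ r), σ⟧ a)
            (𝐃⟦ℤ, (W.torsionGaloisModule m).toTopRep, ((𝓛).level ⊥ r), σ⟧ b)),
      (∀ r, ∀ (φ : contOneCocycles (subgroupRep T'.toTopRep ((𝓛).level ⊥ r)))
        (ψ : contOneCocycles (subgroupRep (W.torsionGaloisModule m).toTopRep ((𝓛).level ⊥ r))),
        (∀ g, ψ.1 g = e (φ.1 g)) → Φ r (oneCocycleClass _ φ) = oneCocycleClass _ ψ) ∧
      ∃ κ : Finset (HeightOneSpectrum (𝓞 ℚ)) → galoisCohomology (W.torsionGaloisModule m) 1,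
        (∀ r : Finset (HeightOneSpectrum (𝓞 ℚ)), ¬ (↑r : Set _) ⊆ Pr → κ r = 0) ∧
        ∀ (r : Finset (HeightOneSpectrum (𝓞 ℚ))) (hr : (↑r : Set _) ⊆ Pr),
          resSubgroup (W.torsionGaloisModule m).toTopRep ((𝓛).level ⊥ r) 1 (κ r) =
            (r.noncommProd 𝐃⟦ℤ, (W.torsionGaloisModule m).toTopRep, ((𝓛).level ⊥ r), σ⟧ (comm r))
              (Φ r (𝐫⟦red, T', ((𝓛).level ⊥ r)⟧
                (c ⊥ ⟨r, fun _ hq => hPr (hr (Finset.mem_coe.2 hq))⟩))) ∧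
          ∀ κ₁ : galoisCohomology (W.torsionGaloisModule m) 1,
            resSubgroup (W.torsionGaloisModule m).toTopRep ((𝓛).level ⊥ r) 1 κ₁ =
              (r.noncommProd 𝐃⟦ℤ, (W.torsionGaloisModule m).toTopRep, ((𝓛).level ⊥ r), σ⟧ (comm r))
                (Φ r (𝐫⟦red, T', ((𝓛).level ⊥ r)⟧
                  (c ⊥ ⟨r, fun _ hq => hPr (hr (Finset.mem_coe.2 hq))⟩))) →
            κ₁ = κ r := by
  classical
  -- the transports (GZ-1), per level and globally
  have hΦex : ∀ r : Finset (HeightOneSpectrum (𝓞 ℚ)), ∃ Φ :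
      continuousCohomology 1 (subgroupRep T'.toTopRep ((𝓛).level ⊥ r)) →+
        continuousCohomology 1 (subgroupRep (W.torsionGaloisModule m).toTopRep ((𝓛).level ⊥ r)),
      ∀ (φ : contOneCocycles (subgroupRep T'.toTopRep ((𝓛).level ⊥ r)))
        (ψ : contOneCocycles (subgroupRep (W.torsionGaloisModule m).toTopRep ((𝓛).level ⊥ r))),
        (∀ g, ψ.1 g = e (φ.1 g)) → Φ (oneCocycleClass _ φ) = oneCocycleClass _ ψ := fun r =>
    exists_addMonoidHom_oneCocycleClass (subgroupRep T'.toTopRep ((𝓛).level ⊥ r))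
      (subgroupRep (W.torsionGaloisModule m).toTopRep ((𝓛).level ⊥ r)) e hec (fun g x => he g x)
  choose Φ hΦ using hΦex
  obtain ⟨Φ₀, hΦ₀⟩ := exists_addEquiv_oneCocycleClass T'.toTopRep (W.torsionGaloisModule m).toTopRep
    e hec he einv hic h₁ h₂
  -- `h0` in `T′`-currency
  have h0' : ∀ r : Finset (HeightOneSpectrum (𝓞 ℚ)), (↑r : Set _) ⊆ Pr →
      ∀ v : T'.toTopRep, (∀ u : (𝓛).level ⊥ r,
        T'.toTopRep.ρ (u : absoluteGaloisGroup ℚ) v = v) → v = 0 := by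
    intro r hr v hv
    have h := h0 r hr (e v) fun u => by
      have := congrArg e (hv u)
      rw [he] at this
      exact this
    have := congrArg einv h
    rwa [h₁, map_zero] at this
  -- existence and uniqueness in `T′` at every level
  have hexT : ∀ (r : Finset (HeightOneSpectrum (𝓞 ℚ))) (hr : (↑r : Set _) ⊆ Pr),
      ∃! κ' : continuousCohomology 1 T'.toTopRep,
        resSubgroup T'.toTopRep ((𝓛).level ⊥ r) 1 κ' =
          (r.noncommProd 𝐃⟦ℤ_[p], T'.toTopRep, ((𝓛).level ⊥ r), σ⟧
            (pairwise_commute_deriv (L := 𝓛) (T' := T') ⊥ r σ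
              (fun ℓ => ((primesEquiv ℓ : Nat.Primes) : ℕ) - 1)))
            (𝐫⟦red, T', ((𝓛).level ⊥ r)⟧
              (c ⊥ ⟨r, fun _ hq => hPr (hr (Finset.mem_coe.2 hq))⟩)) := fun r hr =>
    existsUnique_res_eq_deriv_tate_of_sigma W p S hn hc red hM
      ⟨r, fun _ hq => hPr (hr (Finset.mem_coe.2 hq))⟩
      (fun ℓ hℓ => hKol ℓ (hr (Finset.mem_coe.2 hℓ))) σ (hσ r hr).1 (hσ r hr).2.1 (hσ r hr).2.2
      (h0' r hr) _
  refine ⟨Φ, fun r => pairwise_commute_deriv (L := 𝓛) (T' := W.torsionGaloisModule m) ⊥ r σ _, hΦ,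
    fun r => if hr : (↑r : Set _) ⊆ Pr then Φ₀ (hexT r hr).choose else 0,
    fun r hr => dif_neg hr, fun r hr => ?_⟩
  simp only [dif_pos hr]
  have hκ' := (hexT r hr).choose_spec.1
  refine ⟨?_, fun κ₁ hκ₁ => ?_⟩
  · -- the characterisation, transported (as GZ-2)
    change resSubgroup (W.torsionGaloisModule m).toTopRep ((𝓛).level ⊥ r) 1
      (Φ₀.toAddMonoidHom (hexT r hr).choose) = _
    rw [← comm_resSubgroup T'.toTopRep (W.torsionGaloisModule m).toTopRep e ((𝓛).level ⊥ r)
      Φ₀.toAddMonoidHom (fun φ ψ h => hΦ₀ φ ψ h) (Φ r) (hΦ r) hec he (hexT r hr).choose, hκ',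
      comm_noncommProd_deriv_conjMap T'.toTopRep (W.torsionGaloisModule m).toTopRep e ((𝓛).level ⊥ r)
        σ _ r (Φ r) (hΦ r) hec he]
  · -- uniqueness, pulled back
    have hpre := resSubgroup_symm_eq_noncommProd_deriv T'.toTopRep (W.torsionGaloisModule m).toTopRep e
      hec he einv h₁ h₂ ((𝓛).level ⊥ r) Φ₀ hΦ₀ (Φ r) (hΦ r) σ _ r
      (pairwise_commute_deriv (L := 𝓛) (T' := T') ⊥ r σ
        (fun ℓ => ((primesEquiv ℓ : Nat.Primes) : ℕ) - 1)) _ _ κ₁ hκ₁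
    have h := (hexT r hr).choose_spec.2 (Φ₀.symm κ₁) hpre
    rw [← h, AddEquiv.apply_symm_apply]

end Summit.BirchSwinnertonDyer.Rank1Residual.GaloisImage.Derivative.Rat

end
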